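import Literature.InformationTheory.QuantumCodes.BivariateBicycleCode360
import Literature.InformationTheory.QuantumCodes.TwoBlockWheelComponents
import HarnessLib
import HarnessLib.Audit.Tags

/-!
# The Tanner graphs of the published bivariate-bicycle codes split into two layers of WHEEL GRAPHS
# (Bravyi et al. 2024, Lemma 2 minus planarity, instantiated on `[[72,12,6]]`, `[[90,8,10]]`,
# `[[108,8,10]]`, `[[144,12,12]]`, `[[288,12,18]]`, `[[360,12,≤24]]`) — venture QEC, census family BB,
# layout column (thickness tag)

HONEST FRAMING (qec cell). Column word: PROVED (kernel theorems on the tree's data objects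
`BB.bb72 … BB.bb288`, `BB.bb360`). Bravyi–Cross–Gambetta–Maslov–Rall–Yoder [BravyiEtAl2024, §5 Lemma 2]
state "The Tanner graph of the code `QC(A,B)` has thickness `θ ≤ 2`", proving it by splitting the
Tanner graph into two degree-3 layers `G_A = Tanner([A₂+A₃ | B₃])`, `G_B = Tanner([A₁ | B₁+B₂])` whose
connected components are "wheel graphs" (two cycles of equal length joined by radial edges), which are
planar.  The tree's `BB.Code.exists_wheel_layers` (`TwoBlockWheelComponents.lean`) proves exactly this
structure for every weight-(3,3) two-block code with pairwise distinct terms; PLANARITY of wheel graphs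
(hence "thickness ≤ 2" itself) has no Mathlib counterpart and is NOT asserted.  Below: the structure
theorem instantiated on the six typed codes, with the wheel sizes made explicit
(`prismGraph n` = two `n`-cycles + `n` radial edges; `n = 2·ord(A₃A₂ᵀ)` for the `A`-layer,
`2·ord(B₂B₁ᵀ)` for the `B`-layer, with the printed term order `A = A₁+A₂+A₃`, `B = B₁+B₂+B₃`).

So the census tag `layout=thickness≤2:BCGMRY24-L2(abelian)` on these rows reads: KERNEL structure
theorem (this file) + the pictorial planarity of `C_n □ K₂`.

## References
* [BravyiEtAl2024] Nature 627 (2024) 778 = arXiv:2308.07915, §5 Lemma 2 and its proof (chunk p0010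
  L49–95, p0011 L1–5); Table 3 (the codes; data locators in `BivariateBicycleCodes.lean`,
  `BivariateBicycleCode360.lean`).
-/

namespace Summit.Ventures.QEC.BB

open SimpleGraph
open Literature.InformationTheory.QuantumCodes
open Literature.InformationTheory.QuantumCodes.BB

/-- **`[[72,12,6]]`**: Tanner graph = edge-disjoint union of two layers, every component of either
layer a wheel graph `prismGraph 12` (`A₃A₂ᵀ = y` of order `m = 6`; `B₂B₁ᵀ = xy⁻³` of order `6`). PROVED.
[cite: BravyiEtAl2024, Lemma 2 (arXiv:2308.07915 chunk p0010 L49–95)] -/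
theorem bb72_wheel_layers : ∃ ΓA ΓB : SimpleGraph ((Mono 6 6 ⊕ Mono 6 6) ⊕ (Mono 6 6 ⊕ Mono 6 6)),
    bb72.css.tannerGraph = ΓA ⊔ ΓB ∧ Disjoint ΓA ΓB ∧
    (∀ K : ΓA.ConnectedComponent, Nonempty (K.toSimpleGraph ≃g prismGraph 12)) ∧
    (∀ K : ΓB.ConnectedComponent, Nonempty (K.toSimpleGraph ≃g prismGraph 12)) := by
  have h := bb72.exists_wheel_layers (g₁ := (3, 0)) (g₂ := (0, 1)) (g₃ := (0, 2)) (h₁ := (0, 3))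
    (h₂ := (1, 0)) (h₃ := (2, 0)) (by decide) (by decide) (by decide) (by decide) (by decide) (by decide)
    (fun g => three_monomials_apply_ne_zero_iff 3 0 0 1 0 2 (by decide) (by decide)
      (by decide) g)
    (fun g => three_monomials_apply_ne_zero_iff 0 3 1 0 2 0 (by decide) (by decide)
      (by decide) g)
  have e1 : addOrderOf (((0 : Fin 6), (2 : Fin 6)) - (0, 1)) = 6 :=
    (addOrderOf_eq_iff (by norm_num)).mpr (by decide)
  have e2 : addOrderOf (((1 : Fin 6), (0 : Fin 6)) - (0, 3)) = 6 :=
    (addOrderOf_eq_iff (by norm_num)).mpr (by decide)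
  rw [e1, e2] at h
  exact h

/-- **`[[90,8,10]]`** (`A = x⁹+y+y²`, `B = 1+x²+x⁷` on `ℤ₁₅ × ℤ₃`): two layers of wheel graphs
`prismGraph 6` (`A₃A₂ᵀ = y`, order `3`) and `prismGraph 30` (`B₂B₁ᵀ = x²`, order `15`). PROVED.
[cite: BravyiEtAl2024, Lemma 2 (arXiv:2308.07915 chunk p0010 L49–95)] -/
theorem bb90_wheel_layers : ∃ ΓA ΓB : SimpleGraph ((Mono 15 3 ⊕ Mono 15 3) ⊕ (Mono 15 3 ⊕ Mono 15 3)),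
    bb90.css.tannerGraph = ΓA ⊔ ΓB ∧ Disjoint ΓA ΓB ∧
    (∀ K : ΓA.ConnectedComponent, Nonempty (K.toSimpleGraph ≃g prismGraph 6)) ∧
    (∀ K : ΓB.ConnectedComponent, Nonempty (K.toSimpleGraph ≃g prismGraph 30)) := by
  have h := bb90.exists_wheel_layers (g₁ := (9, 0)) (g₂ := (0, 1)) (g₃ := (0, 2)) (h₁ := (0, 0))
    (h₂ := (2, 0)) (h₃ := (7, 0)) (by decide) (by decide) (by decide) (by decide) (by decide) (by decide)
    (fun g => three_monomials_apply_ne_zero_iff 9 0 0 1 0 2 (by decide) (by decide)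
      (by decide) g)
    (fun g => three_monomials_apply_ne_zero_iff 0 0 2 0 7 0 (by decide) (by decide)
      (by decide) g)
  have e1 : addOrderOf (((0 : Fin 15), (2 : Fin 3)) - (0, 1)) = 3 :=
    (addOrderOf_eq_iff (by norm_num)).mpr (by decide)
  have e2 : addOrderOf (((2 : Fin 15), (0 : Fin 3)) - (0, 0)) = 15 :=
    (addOrderOf_eq_iff (by norm_num)).mpr (by decide)
  rw [e1, e2] at h
  exact h

/-- **`[[108,8,10]]`** (`ℤ₉ × ℤ₆`): two layers of wheel graphs `prismGraph 12` (`A₃A₂ᵀ = y`, order `6`)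
and `prismGraph 36` (`B₂B₁ᵀ = xy⁻³`, order `18`). PROVED.
[cite: BravyiEtAl2024, Lemma 2 (arXiv:2308.07915 chunk p0010 L49–95)] -/
theorem bb108_wheel_layers : ∃ ΓA ΓB : SimpleGraph ((Mono 9 6 ⊕ Mono 9 6) ⊕ (Mono 9 6 ⊕ Mono 9 6)),
    bb108.css.tannerGraph = ΓA ⊔ ΓB ∧ Disjoint ΓA ΓB ∧
    (∀ K : ΓA.ConnectedComponent, Nonempty (K.toSimpleGraph ≃g prismGraph 12)) ∧
    (∀ K : ΓB.ConnectedComponent, Nonempty (K.toSimpleGraph ≃g prismGraph 36)) := by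
  have h := bb108.exists_wheel_layers (g₁ := (3, 0)) (g₂ := (0, 1)) (g₃ := (0, 2)) (h₁ := (0, 3))
    (h₂ := (1, 0)) (h₃ := (2, 0)) (by decide) (by decide) (by decide) (by decide) (by decide) (by decide)
    (fun g => three_monomials_apply_ne_zero_iff 3 0 0 1 0 2 (by decide) (by decide)
      (by decide) g)
    (fun g => three_monomials_apply_ne_zero_iff 0 3 1 0 2 0 (by decide) (by decide)
      (by decide) g)
  have e1 : addOrderOf (((0 : Fin 9), (2 : Fin 6)) - (0, 1)) = 6 :=
    (addOrderOf_eq_iff (by norm_num)).mpr (by decide)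
  have e2 : addOrderOf (((1 : Fin 9), (0 : Fin 6)) - (0, 3)) = 18 :=
    (addOrderOf_eq_iff (by norm_num)).mpr (by decide)
  rw [e1, e2] at h
  exact h

/-- **`[[144,12,12]]`** (the gross code, `ℤ₁₂ × ℤ₆`): two layers of wheel graphs `prismGraph 12`
(`A₃A₂ᵀ = y`, order `m = 6` — the paper's worked example) and `prismGraph 24` (`B₂B₁ᵀ = xy⁻³`,
order `12`). PROVED. [cite: BravyiEtAl2024, Lemma 2 and its example "A₃A₂ᵀ = y²y⁻¹ = y which has order m = 6" (arXiv:2308.07915 chunk p0010 L49–95)] -/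
theorem bb144_wheel_layers :
    ∃ ΓA ΓB : SimpleGraph ((Mono 12 6 ⊕ Mono 12 6) ⊕ (Mono 12 6 ⊕ Mono 12 6)),
    bb144.css.tannerGraph = ΓA ⊔ ΓB ∧ Disjoint ΓA ΓB ∧
    (∀ K : ΓA.ConnectedComponent, Nonempty (K.toSimpleGraph ≃g prismGraph 12)) ∧
    (∀ K : ΓB.ConnectedComponent, Nonempty (K.toSimpleGraph ≃g prismGraph 24)) := by
  have h := bb144.exists_wheel_layers (g₁ := (3, 0)) (g₂ := (0, 1)) (g₃ := (0, 2)) (h₁ := (0, 3))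
    (h₂ := (1, 0)) (h₃ := (2, 0)) (by decide) (by decide) (by decide) (by decide) (by decide) (by decide)
    (fun g => three_monomials_apply_ne_zero_iff 3 0 0 1 0 2 (by decide) (by decide)
      (by decide) g)
    (fun g => three_monomials_apply_ne_zero_iff 0 3 1 0 2 0 (by decide) (by decide)
      (by decide) g)
  have e1 : addOrderOf (((0 : Fin 12), (2 : Fin 6)) - (0, 1)) = 6 :=
    (addOrderOf_eq_iff (by norm_num)).mpr (by decide)
  have e2 : addOrderOf (((1 : Fin 12), (0 : Fin 6)) - (0, 3)) = 12 :=
    (addOrderOf_eq_iff (by norm_num)).mpr (by decide)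
  rw [e1, e2] at h
  exact h

/-- **`[[288,12,18]]`** (`A = x³+y²+y⁷`, `B = y³+x+x²` on `ℤ₁₂ × ℤ₁₂`): two layers of wheel graphs
`prismGraph 24` (`A₃A₂ᵀ = y⁵`, order `12`) and `prismGraph 24` (`B₂B₁ᵀ = xy⁻³`, order `12`). PROVED.
[cite: BravyiEtAl2024, Lemma 2 (arXiv:2308.07915 chunk p0010 L49–95)] -/
theorem bb288_wheel_layers :
    ∃ ΓA ΓB : SimpleGraph ((Mono 12 12 ⊕ Mono 12 12) ⊕ (Mono 12 12 ⊕ Mono 12 12)),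
    bb288.css.tannerGraph = ΓA ⊔ ΓB ∧ Disjoint ΓA ΓB ∧
    (∀ K : ΓA.ConnectedComponent, Nonempty (K.toSimpleGraph ≃g prismGraph 24)) ∧
    (∀ K : ΓB.ConnectedComponent, Nonempty (K.toSimpleGraph ≃g prismGraph 24)) := by
  have h := bb288.exists_wheel_layers (g₁ := (3, 0)) (g₂ := (0, 2)) (g₃ := (0, 7)) (h₁ := (0, 3))
    (h₂ := (1, 0)) (h₃ := (2, 0)) (by decide) (by decide) (by decide) (by decide) (by decide) (by decide)
    (fun g => three_monomials_apply_ne_zero_iff 3 0 0 2 0 7 (by decide) (by decide)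
      (by decide) g)
    (fun g => three_monomials_apply_ne_zero_iff 0 3 1 0 2 0 (by decide) (by decide)
      (by decide) g)
  have e1 : addOrderOf (((0 : Fin 12), (7 : Fin 12)) - (0, 2)) = 12 :=
    (addOrderOf_eq_iff (by norm_num)).mpr (by decide)
  have e2 : addOrderOf (((1 : Fin 12), (0 : Fin 12)) - (0, 3)) = 12 :=
    (addOrderOf_eq_iff (by norm_num)).mpr (by decide)
  rw [e1, e2] at h
  exact h

/-- **`[[360,12,≤24]]`** (`A = x⁹+y+y²`, `B = y³+x²⁵+x²⁶` on `ℤ₃₀ × ℤ₆`): two layers of wheel graphs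
`prismGraph 12` (`A₃A₂ᵀ = y`, order `6`) and `prismGraph 12` (`B₂B₁ᵀ = x²⁵y⁻³`, order `6`). PROVED.
[cite: BravyiEtAl2024, Lemma 2 (arXiv:2308.07915 chunk p0010 L49–95)] -/
theorem bb360_wheel_layers :
    ∃ ΓA ΓB : SimpleGraph ((Mono 30 6 ⊕ Mono 30 6) ⊕ (Mono 30 6 ⊕ Mono 30 6)),
    bb360.css.tannerGraph = ΓA ⊔ ΓB ∧ Disjoint ΓA ΓB ∧
    (∀ K : ΓA.ConnectedComponent, Nonempty (K.toSimpleGraph ≃g prismGraph 12)) ∧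
    (∀ K : ΓB.ConnectedComponent, Nonempty (K.toSimpleGraph ≃g prismGraph 12)) := by
  have h := bb360.exists_wheel_layers (g₁ := (9, 0)) (g₂ := (0, 1)) (g₃ := (0, 2)) (h₁ := (0, 3))
    (h₂ := (25, 0)) (h₃ := (26, 0)) (by decide) (by decide) (by decide) (by decide) (by decide) (by decide)
    (fun g => three_monomials_apply_ne_zero_iff 9 0 0 1 0 2 (by decide) (by decide)
      (by decide) g)
    (fun g => three_monomials_apply_ne_zero_iff 0 3 25 0 26 0 (by decide) (by decide)
      (by decide) g)
  have e1 : addOrderOf (((0 : Fin 30), (2 : Fin 6)) - (0, 1)) = 6 :=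
    (addOrderOf_eq_iff (by norm_num)).mpr (by decide)
  have e2 : addOrderOf (((25 : Fin 30), (0 : Fin 6)) - (0, 3)) = 6 :=
    (addOrderOf_eq_iff (by norm_num)).mpr (by decide)
  rw [e1, e2] at h
  exact h

end Summit.Ventures.QEC.BB
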